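import Mathlib
import Summits.NavierStokesRegularity.NavierStokesRegularity.Theorems.TypeIQuarterGateScarEnvelopeTypeIZoomDictionaryDefs
import Summits.NavierStokesRegularity.NavierStokesRegularity.Theorems.TypeIQuarterGateScarEnvelopeTypeIFatKill
import Summits.NavierStokesRegularity.NavierStokesRegularity.Theorems.TypeIQuarterGateScarEnvelopeTypeIBudgetViolators
import Summits.NavierStokesRegularity.NavierStokesRegularity.Theorems.TypeIQuarterGateScarEnvelopeTypeIOfNoTwinScarObject
import Summits.NavierStokesRegularity.NavierStokesRegularity.Theorems.TypeIQuarterGateQuarterLawTypeIGlue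
import Summits.NavierStokesRegularity.NavierStokesRegularity.Theorems.TypeIQuarterGateEnvelopeQuarterLaw
import Summits.NavierStokesRegularity.NavierStokesRegularity.Theorems.TypeIQuarterGateScarEnvelopeTypeINearOneRateDss
import Literature.Analysis.FluidPDE.AncientAxisymmetricTypeILiouville
import Summits.NavierStokesRegularity.NavierStokesRegularity.Theorems.TypeIQuarterGateScarEnvelopeTypeIZoomDictionaryViscosity

/-!
# Parts H, I, J: the line's statements of record by name, `TameOutside` under the crux hypotheses, and the dictionary AT THE CRUX ITEM

Parts H–J of the plate: `NoSatellite`-named forms, `finalDustOnly_of_fatKill` / `dustKill_iff_sd` / `dustKill_iff_noSatellite`, `TameOutside` is a theorem under `CruxHypotheses`, and section `CruxLevel`: `noSatellite_iff_not_scarViolators`, `scarEnvelopeTypeI_iff_noScarViolators`, the twin-scar residual and the route-level reading of the parent 23726.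

PROVENANCE: declaration texts VERBATIM from the HOME plates of the instrument seat nsreg-p3 (g24/g25, cell
`pub/ns-regularity-ideate`): `round-31/Tangent31prep.lean` v5 (sha16 `e5b8668e3a090216`; = ROUND-30 plate v10 + Part K) and,
for Part L, `round-32/Tangent32prep.lean` v6 (sha16 `6123f27718636121`);
the author cannot write under `Theorems/` (`perm.theorems-prover-only`); landed by the
LEAD-lineage prover ns-sz-p1 g5 on director-ns DIRECTOR-NS #218 (2), split into ≤ 400-line modules (the
plate's `def`s gathered in `TypeIQuarterGateScarEnvelopeTypeIZoomDictionaryDefs`), namespace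
`Summit.NavierStokesRegularity.NavierStokesRegularity.Cruxes.ScarEnvelopeTypeI.ZoomDictionary` (the plate's `NsregP3.R30P`), `E3` spelled out, one-line docstrings
added where the plate had none.  `--supports stmt-NavierStokesRegularity-23843 --as helper`.

HONEST FRAMING: dictionary / census TOOLING for the crux `TypeIQuarterGate.ScarEnvelopeTypeI` (item 23843):
equivalences and normal forms, kernel-checked; NO open statement is proved — 23843, its parent
`QuarterLawTypeI` (23726), the route and Navier–Stokes regularity are OPEN; hard core evaded: none.
-/

-- the summit-side namespace repeats a component by design (single-conjunct summit, D-0017)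
set_option linter.dupNamespace false

open MeasureTheory Set Metric Filter Topology
open scoped ENNReal

namespace Summit.NavierStokesRegularity.NavierStokesRegularity.Cruxes.ScarEnvelopeTypeI.ZoomDictionary

variable {u : ℝ → (EuclideanSpace ℝ (Fin 3)) → (EuclideanSpace ℝ (Fin 3))} {a : (EuclideanSpace ℝ (Fin 3))} {ν T : ℝ}

section ViscosityNormalisation

open Literature.Analysis.FluidPDE
variable {u : ℝ → (EuclideanSpace ℝ (Fin 3)) → (EuclideanSpace ℝ (Fin 3))} {p : ℝ → (EuclideanSpace ℝ (Fin 3)) → ℝ} {a : (EuclideanSpace ℝ (Fin 3))} {ν T : ℝ}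

/-! ### Part H — the line's statements of record, BY NAME

The line `slice_budget` (v8) names the deciding statement `SliceBudget.SD`
(`∀ ν T u p, CruxHypotheses ν T u p → TameOutside T u → OctaveBudget ν T u`, tree
`TypeIQuarterGateSliceBudgetV7Defs`, p621571) and splits it as `FatKill → DustKill → SD` with
`stub_fatKill : FatKill` LANDED (p622339) and `stub_dustKill : DustKill` the only open stub.  Both `SD`
and `DustKill` are equivalent, in the kernel, to the satellite-freeness of Type-I tangent flows. -/

/-- `OctaveBudget ν T u ↔ NoSatellite ν T u` under the crux hypotheses (named form of the dictionary). [folklore] -/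
theorem octaveBudget_iff_noSatellite_named
    (h : Summit.NavierStokesRegularity.NavierStokesRegularity.Cruxes.ScarEnvelopeTypeI.ScarZoom.CruxHypotheses
      ν T u p) :
    Summit.NavierStokesRegularity.NavierStokesRegularity.Cruxes.ScarEnvelopeTypeI.SliceBudget.OctaveBudget
        ν T u ↔ NoSatellite ν T u :=
  octaveBudget_iff_noSatelliteInBall_of_cruxHypotheses_visc h

/-- **`SD` (the registered deciding statement of the line, v1–v8) ⟺ satellite-freeness.** -/
theorem sd_iff_noSatellite :
    Summit.NavierStokesRegularity.NavierStokesRegularity.Cruxes.ScarEnvelopeTypeI.SliceBudget.SD ↔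
      ∀ (ν T : ℝ) (u : ℝ → (EuclideanSpace ℝ (Fin 3)) → (EuclideanSpace ℝ (Fin 3))) (p : ℝ → (EuclideanSpace ℝ (Fin 3)) → ℝ),
        Summit.NavierStokesRegularity.NavierStokesRegularity.Cruxes.ScarEnvelopeTypeI.ScarZoom.CruxHypotheses
            ν T u p →
          Summit.NavierStokesRegularity.NavierStokesRegularity.Cruxes.ScarEnvelopeTypeI.ScarZoom.TameOutside
            T u → NoSatellite ν T u := by
  refine forall_congr' fun ν => forall_congr' fun T => forall_congr' fun u => forall_congr' fun p => ?_
  exact ⟨fun h1 hC hTO => (octaveBudget_iff_noSatellite_named hC).1 (h1 hC hTO),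
    fun h2 hC hTO => (octaveBudget_iff_noSatellite_named hC).2 (h2 hC hTO)⟩

/-- With `stub_fatKill` landed, every A–B-class zoom limit is final-time dust. -/
theorem finalDustOnly_of_fatKill (T : ℝ) (u : ℝ → (EuclideanSpace ℝ (Fin 3)) → (EuclideanSpace ℝ (Fin 3))) (a : (EuclideanSpace ℝ (Fin 3))) :
    Summit.NavierStokesRegularity.NavierStokesRegularity.Cruxes.ScarEnvelopeTypeI.SliceBudget.FinalDustOnly
      T u a :=
  fun M U P H hAB _ =>
    Summit.NavierStokesRegularity.NavierStokesRegularity.Cruxes.ScarEnvelopeTypeI.SliceBudget.stub_fatKill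
      M U P H hAB

/-- `DustKill ⟺ SD` (the wording of record «SK = SD in strength», in the kernel). -/
theorem dustKill_iff_sd :
    Summit.NavierStokesRegularity.NavierStokesRegularity.Cruxes.ScarEnvelopeTypeI.SliceBudget.DustKill ↔
      Summit.NavierStokesRegularity.NavierStokesRegularity.Cruxes.ScarEnvelopeTypeI.SliceBudget.SD :=
  ⟨fun hK ν T u p hC hTO => hK ν T u p hC hTO (finalDustOnly_of_fatKill T u),
    fun hD ν T u p hC hTO _ => hD ν T u p hC hTO⟩

/-- **THE DECIDING STUB OF RECORD ⟺ SATELLITE-FREENESS**: `DustKill` (the statement of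
`stub_dustKill`, the only `sorry` of line `slice_budget` v8) holds iff no Type-I blow-up satisfying the
crux hypotheses and tame outside has, at any singular point, a tangent flow with a final-time
satellite singularity off the blow-up axis. -/
theorem dustKill_iff_noSatellite :
    Summit.NavierStokesRegularity.NavierStokesRegularity.Cruxes.ScarEnvelopeTypeI.SliceBudget.DustKill ↔
      ∀ (ν T : ℝ) (u : ℝ → (EuclideanSpace ℝ (Fin 3)) → (EuclideanSpace ℝ (Fin 3))) (p : ℝ → (EuclideanSpace ℝ (Fin 3)) → ℝ),
        Summit.NavierStokesRegularity.NavierStokesRegularity.Cruxes.ScarEnvelopeTypeI.ScarZoom.CruxHypotheses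
            ν T u p →
          Summit.NavierStokesRegularity.NavierStokesRegularity.Cruxes.ScarEnvelopeTypeI.ScarZoom.TameOutside
            T u → NoSatellite ν T u :=
  dustKill_iff_sd.trans sd_iff_noSatellite

-- negative control (must FAIL if uncommented): nothing here proves the stub
-- example : Summit.NavierStokesRegularity.NavierStokesRegularity.Cruxes.ScarEnvelopeTypeI.SliceBudget.DustKill :=
--   dustKill_iff_noSatellite.2 fun _ _ _ _ _ _ => by simp [NoSatellite]

/-! #### Part I — `TameOutside` is a theorem under the crux hypotheses

The landed STUB 0 of line `scar_zoom`, `ScarZoom.stub_blowupIsCompact : ∀ ν T u p,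
CruxHypotheses ν T u p → TameOutside T u` (Kato theory, p611204), removes the tameness hypothesis
from both statements of record: `SD` and `DustKill` are equivalent to «every Type-I blow-up
satisfying the crux hypotheses is satellite-free». -/

/-- **`SD ⟺ ∀ (crux hypotheses), NoSatellite`** — no `TameOutside` binder. -/
theorem sd_iff_noSatellite' :
    Summit.NavierStokesRegularity.NavierStokesRegularity.Cruxes.ScarEnvelopeTypeI.SliceBudget.SD ↔
      ∀ (ν T : ℝ) (u : ℝ → (EuclideanSpace ℝ (Fin 3)) → (EuclideanSpace ℝ (Fin 3))) (p : ℝ → (EuclideanSpace ℝ (Fin 3)) → ℝ),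
        Summit.NavierStokesRegularity.NavierStokesRegularity.Cruxes.ScarEnvelopeTypeI.ScarZoom.CruxHypotheses
            ν T u p → NoSatellite ν T u :=
  sd_iff_noSatellite.trans
    ⟨fun h ν T u p hC =>
        h ν T u p hC
          (Summit.NavierStokesRegularity.NavierStokesRegularity.Cruxes.ScarEnvelopeTypeI.ScarZoom.stub_blowupIsCompact
            ν T u p hC),
      fun h ν T u p hC _ => h ν T u p hC⟩

/-- **THE DECIDING STUB OF RECORD, FINAL FORM: `DustKill ⟺ ∀ (crux hypotheses), NoSatellite`.**
`stub_dustKill` (the only `sorry` of line `slice_budget` v8) holds iff every Type-I blow-up of a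
smooth Leray–Hopf solution from rapidly decaying data with finitely many scars is satellite-free:
at every singular point, every tangent flow (A–B-class `L³` limit of parabolic zooms of the
unit-viscosity rescaling, any admissible pressure) is essentially bounded near every final-time
point `(0, y')` with `0 < ‖y'‖ < 1`. -/
theorem dustKill_iff_noSatellite' :
    Summit.NavierStokesRegularity.NavierStokesRegularity.Cruxes.ScarEnvelopeTypeI.SliceBudget.DustKill ↔
      ∀ (ν T : ℝ) (u : ℝ → (EuclideanSpace ℝ (Fin 3)) → (EuclideanSpace ℝ (Fin 3))) (p : ℝ → (EuclideanSpace ℝ (Fin 3)) → ℝ),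
        Summit.NavierStokesRegularity.NavierStokesRegularity.Cruxes.ScarEnvelopeTypeI.ScarZoom.CruxHypotheses
            ν T u p → NoSatellite ν T u :=
  dustKill_iff_sd.trans sd_iff_noSatellite'

end ViscosityNormalisation

section CruxLevel

open Summit.NavierStokesRegularity.NavierStokesRegularity.Cruxes.ScarEnvelopeTypeI
open Summit.NavierStokesRegularity.NavierStokesRegularity.Theses.TypeIQuarterGate
  (ScarEnvelopeTypeI FiniteScarsTypeI QuarterLawTypeI)

/-- `SD ⟺ the crux item 23843` — the tree's reduction, read on the named Prop `SliceBudget.SD`. -/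
theorem sd_iff_scarEnvelopeTypeI : SliceBudget.SD ↔ ScarEnvelopeTypeI :=
  SliceBudget.scarEnvelopeTypeI_iff_sliceOctaveBudget

/-- `DustKill ⟺ the crux item 23843`: the only `sorry` of line `slice_budget` v8 is the crux in strength. -/
theorem dustKill_iff_scarEnvelopeTypeI : SliceBudget.DustKill ↔ ScarEnvelopeTypeI :=
  dustKill_iff_sd.trans sd_iff_scarEnvelopeTypeI

/-- **THE CRUX ITEM ⟺ SATELLITE-FREENESS (headline of ROUND-30).**  `TypeIQuarterGate.ScarEnvelopeTypeI`
(stmt-NavierStokesRegularity-23843: finitely many scars + the sup-norm Type-I rate ⇒ the scar envelope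
`|u(x,t)| ≤ C' + Σ_{a∈σ} C'/(|x−a| + √(T−t))`) holds iff every Type-I blow-up of a smooth Leray–Hopf
solution from rapidly decaying data with finitely many scars is SATELLITE-FREE: at every singular point
of the unit-viscosity rescaling, for every admissible pressure, every tangent flow (A–B-class `L³` limit
of parabolic zooms) is essentially bounded near every final-time point `(0, y')`, `0 < ‖y'‖ < 1`. -/
theorem scarEnvelopeTypeI_iff_noSatellite :
    ScarEnvelopeTypeI ↔
      ∀ (ν T : ℝ) (u : ℝ → (EuclideanSpace ℝ (Fin 3)) → (EuclideanSpace ℝ (Fin 3))) (p : ℝ → (EuclideanSpace ℝ (Fin 3)) → ℝ),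
        ScarZoom.CruxHypotheses ν T u p → NoSatellite ν T u :=
  sd_iff_scarEnvelopeTypeI.symm.trans sd_iff_noSatellite'

/-- **Pointwise reading**: under the crux hypotheses, satellite-freeness of `(u, T)` ⟺ there is no
scar-violator sequence `(x_k, t_k)` (`x_k → a`, `t_k → T`, `|x_k − a|·|u(t_k,x_k)| → ∞`,
`(T − t_k)/|x_k − a|² → 0`; tree `ScarZoom.ScarViolators`). -/
theorem noSatellite_iff_not_scarViolators {ν T : ℝ} {u : ℝ → (EuclideanSpace ℝ (Fin 3)) → (EuclideanSpace ℝ (Fin 3))} {p : ℝ → (EuclideanSpace ℝ (Fin 3)) → ℝ}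
    (h : ScarZoom.CruxHypotheses ν T u p) :
    NoSatellite ν T u ↔ ¬ ScarZoom.ScarViolators T u :=
  (octaveBudget_iff_noSatellite_named h).symm.trans (SliceBudget.octaveBudget_iff_not_scarViolators h)

/-- The crux item ⟺ no crux-class Type-I blow-up carries a scar-violator sequence. -/
theorem scarEnvelopeTypeI_iff_noScarViolators :
    ScarEnvelopeTypeI ↔
      ∀ (ν T : ℝ) (u : ℝ → (EuclideanSpace ℝ (Fin 3)) → (EuclideanSpace ℝ (Fin 3))) (p : ℝ → (EuclideanSpace ℝ (Fin 3)) → ℝ),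
        ScarZoom.CruxHypotheses ν T u p → ¬ ScarZoom.ScarViolators T u :=
  scarEnvelopeTypeI_iff_noSatellite.trans
    (forall_congr' fun _ => forall_congr' fun _ => forall_congr' fun _ => forall_congr' fun _ =>
      ⟨fun h1 hC => (noSatellite_iff_not_scarViolators hC).1 (h1 hC),
        fun h2 hC => (noSatellite_iff_not_scarViolators hC).2 (h2 hC)⟩)

/-- **What a satellite produces**: if a crux-class Type-I blow-up is NOT satellite-free, its scar
violators zoom to an Albritton–Barker-class TWIN-SCAR OBJECT (a Type-I ancient mild solution singular
at the final time at `0` and at a unit vector, suitable weak in every ball about the top vertex) —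
the residual enemy of BOTH 23843 lines, typed. -/
theorem exists_twinScarObject_of_not_noSatellite {ν T : ℝ} {u : ℝ → (EuclideanSpace ℝ (Fin 3)) → (EuclideanSpace ℝ (Fin 3))} {p : ℝ → (EuclideanSpace ℝ (Fin 3)) → ℝ}
    (h : ScarZoom.CruxHypotheses ν T u p) (hns : ¬ NoSatellite ν T u) :
    ∃ (M : ℝ) (v : ℝ → (EuclideanSpace ℝ (Fin 3)) → (EuclideanSpace ℝ (Fin 3))) (P : ℝ → (EuclideanSpace ℝ (Fin 3)) → ℝ), ScarZoom.TwinScarObject M v ∧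
      ∀ R : ℝ, 0 < R → Literature.Analysis.FluidPDE.IsSuitableWeakSolutionInBall R 0 v P :=
  SliceBudget.exists_twinScarObject_inBall_of_not_octaveBudget h
    fun hB => hns ((octaveBudget_iff_noSatellite_named h).1 hB)

/-- S_C (line `scar_zoom`'s deciding stub `stub_noCascadeSplitting`, OPEN) ⟹ satellite-freeness. -/
theorem noSatellite_of_noTwinScarObject
    (hC : ∀ (M : ℝ) (v : ℝ → (EuclideanSpace ℝ (Fin 3)) → (EuclideanSpace ℝ (Fin 3))), ¬ ScarZoom.TwinScarObject M v) :
    ∀ (ν T : ℝ) (u : ℝ → (EuclideanSpace ℝ (Fin 3)) → (EuclideanSpace ℝ (Fin 3))) (p : ℝ → (EuclideanSpace ℝ (Fin 3)) → ℝ),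
      ScarZoom.CruxHypotheses ν T u p → NoSatellite ν T u :=
  scarEnvelopeTypeI_iff_noSatellite.1 (SliceBudget.scarEnvelopeTypeI_of_noTwinScarObject hC)

/-- S_C′ (the thinner wall: no twin-scar object lies, with some pressure, in A–B's class on every
ball; OPEN) ⟹ satellite-freeness. -/
theorem noSatellite_of_noABTwinScarObject
    (hSC : ∀ (M : ℝ) (v : ℝ → (EuclideanSpace ℝ (Fin 3)) → (EuclideanSpace ℝ (Fin 3))) (P : ℝ → (EuclideanSpace ℝ (Fin 3)) → ℝ), ScarZoom.TwinScarObject M v →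
      ¬ ∀ R : ℝ, 0 < R → Literature.Analysis.FluidPDE.IsSuitableWeakSolutionInBall R 0 v P) :
    ∀ (ν T : ℝ) (u : ℝ → (EuclideanSpace ℝ (Fin 3)) → (EuclideanSpace ℝ (Fin 3))) (p : ℝ → (EuclideanSpace ℝ (Fin 3)) → ℝ),
      ScarZoom.CruxHypotheses ν T u p → NoSatellite ν T u :=
  fun _ν _T _u _p h =>
    (octaveBudget_iff_noSatellite_named h).1 (SliceBudget.octaveBudget_of_noABTwinScarObject hSC h)

/-- **Route-level reading** (route `TypeIQuarterGate`, parent item 23726): with the landed children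
23844 (`EnvelopeQuarterLaw`) and 23845 (glue), Leray's quarter rate on Type-I blow-ups follows from
FINITE SCARS (23842, open) and SATELLITE-FREENESS of Type-I tangent flows (= 23843, open). -/
theorem quarterLawTypeI_of_finiteScars_of_noSatellite (hF : FiniteScarsTypeI)
    (hN : ∀ (ν T : ℝ) (u : ℝ → (EuclideanSpace ℝ (Fin 3)) → (EuclideanSpace ℝ (Fin 3))) (p : ℝ → (EuclideanSpace ℝ (Fin 3)) → ℝ),
      ScarZoom.CruxHypotheses ν T u p → NoSatellite ν T u) :
    QuarterLawTypeI :=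
  Summit.NavierStokesRegularity.NavierStokesRegularity.Theorems.typeIQuarterGate_quarterLawTypeIGlue_proof
    hF (scarEnvelopeTypeI_iff_noSatellite.2 hN)
    Summit.NavierStokesRegularity.NavierStokesRegularity.Theorems.typeIQuarterGate_envelopeQuarterLaw_proof

-- negative controls (each must FAIL if uncommented): Part J proves no open statement
-- example : ScarEnvelopeTypeI := scarEnvelopeTypeI_iff_noSatellite.2 fun _ _ _ _ _ => by
--   simp [NoSatellite]
-- example : SliceBudget.DustKill := dustKill_iff_scarEnvelopeTypeI.2 fun _ _ _ _ _ _ _ _ _ _ _ => by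
--   simp

end CruxLevel

end Summit.NavierStokesRegularity.NavierStokesRegularity.Cruxes.ScarEnvelopeTypeI.ZoomDictionary
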